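import Literature.AlgebraicGeometry.HodgeTheory.SkewVanishingLattice
import Literature.LinearAlgebra.Alternating.DarbouxBasis
import Literature.LinearAlgebra.Matrix.SymplecticNormalSubgroups
import Mathlib.LinearAlgebra.FiniteDimensional.Defs
import Mathlib.LinearAlgebra.Matrix.BilinearForm
import Mathlib.Data.Complex.Basic
import HarnessLib

/-!
# Deligne's one-orbit lemma: a symplectic group generated by the one-parameter transvection groups
along a single spanning orbit is `Sp(V)` (Weil II, Lemme 4.4.2^α; named fact)

Family `hodge`, layer `Literature/AlgebraicGeometry/HodgeTheory` (vocabulary of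
`HodgeTheory/SkewVanishingLattice`: `skewTransvection B v`, `transvectionGroup B Δ ≤ GL(V)`).
Consumer: the big-monodromy step of Lefschetz-pencil arguments (Deligne, Weil II, Thm. 4.4.1:
for `n` odd the monodromy of a Lefschetz pencil is Zariski-dense in `Sp`; cell `hodge-nonav`, route
`SignSymmetricPowers`, where the ONE-orbit hypothesis is exactly what fails for symmetric families
and is replaced by a two-orbit variant).

Source, read (held text `paper:doi-10-1007-bf02684780`, PDF p. 92 = journal p. 227; P. Deligne,
*La conjecture de Weil : II*, Publ. Math. IHÉS 52 (1980), §4.4 "La monodromie des pinceaux de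
Lefschetz"):

> **Lemme (4.4.2^α).** Soit `V` un `ℂ`-espace vectoriel de dimension finie muni d'une forme
> alternée non dégénérée `⟨ , ⟩`, `M` un sous-groupe algébrique de `Sp(V)` et `R` une orbite de `M`
> dans `V`, qui engendre `V`. On suppose que `M` est le plus petit sous-groupe algébrique de `Sp(V)`
> contenant les transvections `x ↦ x + ⟨x, δ⟩ δ` (`δ ∈ R`). En d'autres termes, on suppose que `M`
> est engendré par les sous-groupes à un paramètre de transvections
> `U_δ = {x ↦ x + λ ⟨x, δ⟩ δ | λ ∈ ℂ}` pour `δ ∈ R`. Alors, `M = Sp(V)`.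

(Proof: loc. cit. (4.4.3^α)–(4.4.4^α), pp. 227–228. The companion Lemme (4.4.2^β) — symmetric form,
reflections `x ↦ x - ⟨x, δ⟩ δ` with `⟨δ, δ⟩ = 2`: "`M` est fini ou `M = O(V)`" — concerns the
Zariski closure of a reflection group and is NOT vendored here.)

## Rendering

Deligne's second formulation ("en d'autres termes") is used: `M` is the subgroup of `GL(V)`
GENERATED by the one-parameter groups `U_δ`, `δ ∈ R` — an abstract subgroup, which is automatically
a (connected) algebraic subgroup, being generated by connected one-parameter unipotent groups, so
nothing is lost and no Zariski topology is needed; "`R` une orbite de `M`" is `M`-stability plus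
`M`-transitivity of `R`; "`M = Sp(V)`" is stated pointwise: an invertible endomorphism lies in `M`
iff it preserves `⟨ , ⟩`. Field `ℂ` as printed (Deligne: "on a subrepticement remplacé `ℚ̄_ℓ` par
le corps isomorphe `ℂ`").

* `oneParamTransvection B δ c` — `x ↦ x + c ⟨x, δ⟩ δ` (Deligne's elements of `U_δ`; for `c = -1`
  this is Schnell's `skewTransvection B δ` of `SkewVanishingLattice`, `oneParamTransvection_neg_one`).
* `oneParamTransvectionGroup B R ≤ GL(V)` — Deligne's `M`: generated by the `U_δ`, `δ ∈ R`.
* PROVED: the `U_δ` preserve an alternating form (`apply_oneParamTransvection_apply`), hence so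
  does `M` (`oneParamTransvectionGroup_isometry`) — the inclusion `M ⊆ Sp(V)`; and
  `transvectionGroup B R ≤ oneParamTransvectionGroup B R`.
* NAMED FACT `Deligne1980_oneParamTransvectionGroup_eq_sp` — Lemme (4.4.2^α).

## Part II (appended 2026-08-27): the lemma PROVED — "Lemma T" and `Deligne1980_oneParamTransvectionGroup_eq_sp_holds`

Deligne's printed proof, verbatim (held text PDF pp. 92–93 = journal pp. 227–228):

> **Lemme (4.4.3^α).** Soient `δ'`, `δ'' ∈ R`, non orthogonaux. Alors, les combinaisons linéaires non
> nulles de `δ'` et `δ''` sont dans `R`. — Le sous-groupe de `G` engendré par `U_δ'` et `U_δ''` est le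
> groupe `SL(2)` du plan tendu par `δ'` et `δ''`. Il est dans `M`, et les vecteurs non nuls de ce plan
> forment une seule orbite pour `SL(2)`.
> **(4.4.4^α)** Prouvons (4.4.2^α). Le cas `R = {0}` est trivial. Excluons-le. Si `δ ∈ R`, on a alors
> `δ ≠ 0`, et il existe `δ' ∈ R` tel que `(δ, δ') ≠ 0` (puisque `R` engendre `V` et que `( , )` est non
> dégénérée). D'après (4.4.3^α), les multiples non nuls de `δ` sont donc dans `R`. Soit `W` un sous-espace
> maximal de `V` tel que `R ∩ W` soit dense dans `W`. On a `W ≠ 0`. S'il existe `δ ∈ R − W` qui n'est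
> pas orthogonal à `W`, il résulte de (4.4.3^α) que `R` est dense dans `W ⊕ Cδ`. Ceci contredit la
> maximalité de `W`. On a donc `R = (R ∩ W) ∪ (R ∩ W^⊥)`. Puisque `R` engendre `V`, on a `V = W + W^⊥`,
> et `W` est non isotrope. Le groupe `M` est engendré par les `U_δ` (`δ ∈ R`), donc contenu dans
> `Sp(W) × Sp(W^⊥)`. Puisque `R` est une seule orbite de `M`, on a `R ⊂ W` et `W = V` : `R` est dense
> dans `V`, les `U_δ` (`δ ∈ V`) sont tous dans `M`, et `M = Sp(V)`.

The architecture is followed with ONE change forced by the abstract-group rendering of `M` (no Zariski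
topology): instead of "`R ∩ W` dense in `W`" the induction carries the EXACT set
`L = {v | U_v(c) ∈ M for all c}` of ADMISSIBLE CENTRES (`IsCentre`, §5) and the invariant "every vector of
`W` outside the radical of `( , )|W` is an admissible centre"; (4.4.3^α) becomes the closure rules of §5
(`IsCentre.smul`, `.map`, `.add_smul_of_ne`: `U_w(c) v = v + c⟨v, w⟩w`), the maximality step becomes the
growth lemma of §6 (`isCentre_add_of_step`: add a `ρ ∈ R` linked to `W`; the one delicate case — `w ∈ W`
admissible but `⟨w, ρ⟩ = 0` — is settled by a pivot `u ∈ W` avoiding three hyperplanes, whence the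
hypothesis that `K` is INFINITE), and "`R = (R ∩ W) ∪ (R ∩ W^⊥)` is impossible" is exactly the
ORTHOGONAL CONNECTEDNESS of `R` (`isCentre_of_span_eq_top`: no partition of `R` into two non-empty
mutually orthogonal parts), which is all that the one-orbit hypothesis is used for
(`orthogonallyConnected_of_orbit`, §8: each `U_δ`, `δ ∈ R`, preserves such a partition). The last
sentence ("les `U_δ` (`δ ∈ V`) sont tous dans `M`, et `M = Sp(V)`") is Artin's theorem that `Sp(V)` is
generated by the symplectic transvections, taken from the tree IN MATRIX FORM
(`Literature.LinearAlgebra.Matrix.SymplecticMatrix.closure_transvec_eq_top`, [Artin1988, Chap. III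
Thm 3.25]) and transported along a Darboux basis (`Literature.LinearAlgebra.Alternating.exists_symplecticBasis`,
§7: `unitOfSymplecticMatrix`, `toLin_transvec` — the tree's `transvec w c` is `U_{b⁻¹w}(-c)`).

* §5 `IsCentre B R v` (def) and its closure rules; §6 `exists_mem_forall_three_ne_zero` (hyperplane
  avoidance over an infinite field), `isCentre_add_of_step`, `isCentre_of_mem_sup`,
  `isCentre_invariant_insert`, **`isCentre_of_span_eq_top`** (every vector is an admissible centre when `R`
  spans and is orthogonally connected); §7 `unitOfSymplecticMatrix` (def, `Sp_{2ι}(K) →* GL(V)`),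
  `toMatrix_eq_J`, `apply_eq_dotProduct_J_mulVec`, `toMatrix_mem_symplecticGroup`, `toLin_transvec`,
  **`mem_oneParamTransvectionGroup_of_forall_isCentre`** (any field); §8
  **`mem_oneParamTransvectionGroup_iff_of_connected`** ("LEMMA T", group form: `K` infinite, `R` spanning
  and orthogonally connected ⇒ `M = Sp(V)` — the transvection-density statement used by the route
  `Summits/HodgeConjecture/HodgeConjecture/Theses/SignSymmetricPowers.lean` (memo ROUTE-P3v11 §3.5, whose
  Corollary T′ is the reduction "type graph connected ⇒ orthogonality graph connected"); it is also the
  case "one orbit of centres spans `V`, the axes span `V*`" of McLaughlin's theorem on groups generated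
  by full transvection subgroups [McLaughlin1967], in Cameron–Hall's formulation [CameronHall1991, Thm 2]
  as reported in arXiv:0705.2332 Thm 22), `orthogonallyConnected_of_orbit`, and the DISCHARGE
  **`Deligne1980_oneParamTransvectionGroup_eq_sp_holds`** (net debt −1).

## References

* [Deligne1980] P. Deligne, La conjecture de Weil : II, Publ. Math. IHÉS 52 (1980) 137–252, §4.4,
  Lemme (4.4.2^α) p. 227, proof (4.4.3^α)–(4.4.4^α) pp. 227–228 (held text PDF pp. 92–93).
* [Schnell2010] C. Schnell, Primitive cohomology and the tube mapping, Math. Z. 268 (2010), §7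
  (the transvection vocabulary of `SkewVanishingLattice`).
* [Artin1988] E. Artin, Geometric Algebra (1957/1988), Chap. III §5, Thm 3.25 (`Sp` is generated by
  symplectic transvections; tree `Literature/LinearAlgebra/Matrix/SymplecticNormalSubgroups.lean`).
* [Lang2002] S. Lang, Algebra, GTM 211, Ch. XV §8 Thm 8.1 (Darboux basis; tree
  `Literature/LinearAlgebra/Alternating/DarbouxBasis.lean`).
* [McLaughlin1967] J. McLaughlin, Some groups generated by transvections, Arch. Math. 18 (1967) 364–368.
* [CameronHall1991] P. J. Cameron, J. I. Hall, Some groups generated by transvection subgroups,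
  J. Algebra 140 (1991) 184–209, Thm 2 (restated as Thm 22 of arXiv:0705.2332, held text p0014).
-/

noncomputable section

namespace Literature.AlgebraicGeometry.HodgeTheory

section Transvections

variable {K : Type*} [CommRing K] {V : Type*} [AddCommGroup V] [Module K V]
  (B : LinearMap.BilinForm K V)

/-- Deligne's **one-parameter transvection** `x ↦ x + c ⟨x, δ⟩ δ` along `δ` with parameter `c`
(the elements of "`U_δ = {x ↦ x + λ ⟨x, δ⟩ δ | λ ∈ ℂ}`"). [cite: Deligne1980, §4.4 Lemme (4.4.2^α) p. 227] -/
def oneParamTransvection (δ : V) (c : K) : V →ₗ[K] V :=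
  LinearMap.id + c • (B.flip δ).smulRight δ

/-- `U_δ(c)(x) = x + (c ⟨x, δ⟩) δ`. [cite: Deligne1980, §4.4 Lemme (4.4.2^α) p. 227] -/
@[simp]
theorem oneParamTransvection_apply (δ : V) (c : K) (x : V) :
    oneParamTransvection B δ c x = x + (c * B x δ) • δ := by
  simp [oneParamTransvection, smul_smul]

/-- Parameter `-1` gives Schnell's transvection `T_δ(x) = x - ⟨x, δ⟩ δ` of `SkewVanishingLattice`.
[cite: Schnell2010, §7 (Skew-symmetric vanishing lattices)] -/
theorem oneParamTransvection_neg_one (δ : V) :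
    oneParamTransvection B δ (-1) = skewTransvection B δ := by
  ext x
  rw [oneParamTransvection_apply, skewTransvection_apply, neg_one_mul, neg_smul, sub_eq_add_neg]

/-- Parameter `0` gives the identity `U_δ(0) = 1` (the neutral element of the one-parameter group
`U_δ`). [cite: Deligne1980, §4.4 Lemme (4.4.2^α) p. 227] -/
@[simp]
theorem oneParamTransvection_zero (δ : V) : oneParamTransvection B δ 0 = LinearMap.id := by
  ext x
  simp

/-- `U_δ` is a one-parameter group when `⟨δ, δ⟩ = 0` (always, for alternating `B`):
`U_δ(c) ∘ U_δ(c') = U_δ(c + c')`. [cite: Deligne1980, §4.4 Lemme (4.4.2^α) p. 227] -/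
theorem oneParamTransvection_comp {δ : V} (hδ : B δ δ = 0) (c c' : K) :
    oneParamTransvection B δ c ∘ₗ oneParamTransvection B δ c' = oneParamTransvection B δ (c + c') := by
  ext x
  have h1 : B ((c' * B x δ) • δ) δ = 0 := by
    rw [map_smul, LinearMap.smul_apply, hδ, smul_zero]
  simp only [LinearMap.coe_comp, Function.comp_apply, oneParamTransvection_apply]
  rw [map_add, LinearMap.add_apply, h1, add_zero]
  module

/-- For `⟨δ, δ⟩ = 0`, `U_δ(c)` is invertible with inverse `U_δ(-c)`: the linear equivalence.
[cite: Deligne1980, §4.4 Lemme (4.4.2^α) p. 227] -/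
def oneParamTransvectionEquiv {δ : V} (hδ : B δ δ = 0) (c : K) : V ≃ₗ[K] V :=
  LinearEquiv.ofLinear (oneParamTransvection B δ c) (oneParamTransvection B δ (-c))
    (by rw [oneParamTransvection_comp B hδ, add_neg_cancel, oneParamTransvection_zero])
    (by rw [oneParamTransvection_comp B hδ, neg_add_cancel, oneParamTransvection_zero])

/-- The underlying map of `oneParamTransvectionEquiv` is `U_δ(c)` (unfolding). [cite: Deligne1980, §4.4 Lemme (4.4.2^α) p. 227] -/
@[simp]
theorem coe_oneParamTransvectionEquiv {δ : V} (hδ : B δ δ = 0) (c : K) :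
    (oneParamTransvectionEquiv B hδ c : V →ₗ[K] V) = oneParamTransvection B δ c := rfl

/-- **The transvections `U_δ(c)` preserve an alternating form**:
`⟨U_δ(c) x, U_δ(c) y⟩ = ⟨x, y⟩`. [cite: Deligne1980, §4.4 Lemme (4.4.2^α) p. 227] -/
theorem apply_oneParamTransvection_apply (hB : B.IsAlt) (δ : V) (c : K) (x y : V) :
    B (oneParamTransvection B δ c x) (oneParamTransvection B δ c y) = B x y := by
  have h1 : B δ δ = 0 := hB δ
  have h2 : B δ y = -B y δ := (hB.neg_eq y δ).symm
  simp only [oneParamTransvection_apply, map_add, map_smul, LinearMap.add_apply,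
    LinearMap.smul_apply, smul_eq_mul, h1, h2, mul_zero, add_zero]
  ring

/-- **Deligne's group `M`**: the subgroup of `GL(V) = (End V)ˣ` generated by the one-parameter
transvection groups `U_δ = {x ↦ x + c ⟨x, δ⟩ δ | c}`, `δ ∈ R` ("on suppose que `M` est engendré par
les sous-groupes à un paramètre de transvections `U_δ` pour `δ ∈ R`"): generated by the invertible
endomorphisms whose underlying linear map is some `U_δ(c)`. [cite: Deligne1980, §4.4 Lemme (4.4.2^α) p. 227] -/
def oneParamTransvectionGroup (R : Set V) : Subgroup (V →ₗ[K] V)ˣ :=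
  Subgroup.closure {u | ∃ δ ∈ R, ∃ c : K, (u : V →ₗ[K] V) = oneParamTransvection B δ c}

/-- `M` is monotone in `R` (more generating one-parameter groups, larger group). [cite: Deligne1980, §4.4 Lemme (4.4.2^α) p. 227] -/
theorem oneParamTransvectionGroup_mono {R R' : Set V} (h : R ⊆ R') :
    oneParamTransvectionGroup B R ≤ oneParamTransvectionGroup B R' :=
  Subgroup.closure_mono fun _ ⟨δ, hδ, c, hu⟩ ↦ ⟨δ, h hδ, c, hu⟩

/-- For `⟨δ, δ⟩ = 0` and `δ ∈ R`, the unit `U_δ(c) ∈ GL(V)` lies in `M`. [cite: Deligne1980, §4.4 Lemme (4.4.2^α) p. 227] -/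
theorem unit_oneParamTransvection_mem {R : Set V} {δ : V} (hδR : δ ∈ R) (hδ : B δ δ = 0) (c : K) :
    LinearMap.GeneralLinearGroup.ofLinearEquiv (oneParamTransvectionEquiv B hδ c) ∈
      oneParamTransvectionGroup B R :=
  Subgroup.subset_closure ⟨δ, hδR, c, rfl⟩

/-- Schnell's monodromy group `Γ_R` (generated by the `T_δ = U_δ(-1)`) is contained in Deligne's
`M`. [cite: Deligne1980, §4.4 Lemme (4.4.2^α) p. 227] [cite: Schnell2010, §7] -/
theorem transvectionGroup_le_oneParamTransvectionGroup (R : Set V) :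
    transvectionGroup B R ≤ oneParamTransvectionGroup B R :=
  Subgroup.closure_mono fun _ ⟨δ, hδ, hu⟩ ↦ ⟨δ, hδ, -1, by rw [hu, oneParamTransvection_neg_one]⟩

/-- **`M ⊆ Sp(V)`**: every element of the group generated by the `U_δ` preserves the alternating
form (the easy inclusion of `M = Sp(V)`). [cite: Deligne1980, §4.4 Lemme (4.4.2^α) p. 227] -/
theorem oneParamTransvectionGroup_isometry (hB : B.IsAlt) {R : Set V} {g : (V →ₗ[K] V)ˣ}
    (hg : g ∈ oneParamTransvectionGroup B R) (x y : V) :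
    B ((g : V →ₗ[K] V) x) ((g : V →ₗ[K] V) y) = B x y := by
  induction hg using Subgroup.closure_induction generalizing x y with
  | mem u hu =>
    obtain ⟨δ, -, c, hu⟩ := hu
    rw [hu, apply_oneParamTransvection_apply B hB]
  | one => rfl
  | mul u v _ _ hu hv => rw [Units.val_mul, Module.End.mul_apply, Module.End.mul_apply, hu, hv]
  | inv u _ hu =>
    have key := hu ((↑u⁻¹ : V →ₗ[K] V) x) ((↑u⁻¹ : V →ₗ[K] V) y)
    rw [← Module.End.mul_apply, ← Module.End.mul_apply (f := (u : V →ₗ[K] V)), ← Units.val_mul,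
      mul_inv_cancel, Units.val_one, Module.End.one_apply, Module.End.one_apply] at key
    exact key.symm

end Transvections

section Deligne

/-- **Deligne's one-orbit lemma** (Weil II, Lemme (4.4.2^α); named fact). Let `V` be a
finite-dimensional `ℂ`-vector space with a non-degenerate alternating form `⟨ , ⟩`, `R ⊆ V` a
subset spanning `V`, and `M ≤ GL(V)` the subgroup generated by the one-parameter transvection
groups `U_δ = {x ↦ x + λ ⟨x, δ⟩ δ | λ ∈ ℂ}`, `δ ∈ R` (`oneParamTransvectionGroup`); assume `R` is a
single orbit of `M` (`M`-stable and `M`-transitive). Then `M = Sp(V)`: an automorphism of `V` lies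
in `M` iff it preserves `⟨ , ⟩`. Printed: "Soit `V` un `ℂ`-espace vectoriel de dimension finie
muni d'une forme alternée non dégénérée `⟨ , ⟩`, `M` un sous-groupe algébrique de `Sp(V)` et `R`
une orbite de `M` dans `V`, qui engendre `V`. On suppose que `M` est le plus petit sous-groupe
algébrique de `Sp(V)` contenant les transvections `x ↦ x + ⟨x, δ⟩ δ` (`δ ∈ R`). En d'autres
termes, on suppose que `M` est engendré par les sous-groupes à un paramètre de transvections `U_δ`
pour `δ ∈ R`. Alors, `M = Sp(V)`." (The abstract group generated by the `U_δ` is the algebraic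
group they generate — module docstring.) [cite: Deligne1980, §4.4 Lemme (4.4.2^α) p. 227 (held text PDF p. 92)] -/
def Deligne1980_oneParamTransvectionGroup_eq_sp : Prop :=
  ∀ (V : Type) [AddCommGroup V] [Module ℂ V] [FiniteDimensional ℂ V] (B : LinearMap.BilinForm ℂ V),
    B.IsAlt → B.Nondegenerate → ∀ R : Set V, Submodule.span ℂ R = ⊤ →
      (∀ g ∈ oneParamTransvectionGroup B R, ∀ δ ∈ R, (g : V →ₗ[ℂ] V) δ ∈ R) →
      (∀ δ ∈ R, ∀ δ' ∈ R, ∃ g ∈ oneParamTransvectionGroup B R, (g : V →ₗ[ℂ] V) δ = δ') →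
        ∀ g : (V →ₗ[ℂ] V)ˣ, g ∈ oneParamTransvectionGroup B R ↔
          ∀ x y : V, B ((g : V →ₗ[ℂ] V) x) ((g : V →ₗ[ℂ] V) y) = B x y

/-- The content of the lemma is the inclusion `Sp(V) ⊆ M`; the converse inclusion holds
unconditionally (`oneParamTransvectionGroup_isometry`). Unpacked form for consumers: under the
hypotheses, every isometry of `⟨ , ⟩` lies in `M`. [cite: Deligne1980, §4.4 Lemme (4.4.2^α) p. 227] -/
theorem Deligne1980_oneParamTransvectionGroup_eq_sp.mem_of_isometry
    (h : Deligne1980_oneParamTransvectionGroup_eq_sp) {V : Type} [AddCommGroup V] [Module ℂ V]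
    [FiniteDimensional ℂ V] {B : LinearMap.BilinForm ℂ V} (hB : B.IsAlt) (hBn : B.Nondegenerate)
    {R : Set V} (hR : Submodule.span ℂ R = ⊤)
    (hst : ∀ g ∈ oneParamTransvectionGroup B R, ∀ δ ∈ R, (g : V →ₗ[ℂ] V) δ ∈ R)
    (htr : ∀ δ ∈ R, ∀ δ' ∈ R, ∃ g ∈ oneParamTransvectionGroup B R, (g : V →ₗ[ℂ] V) δ = δ')
    {g : (V →ₗ[ℂ] V)ˣ} (hg : ∀ x y : V, B ((g : V →ₗ[ℂ] V) x) ((g : V →ₗ[ℂ] V) y) = B x y) :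
    g ∈ oneParamTransvectionGroup B R :=
  (h V B hB hBn R hR hst htr g).2 hg

end Deligne

/-! ## Part II, §5. Admissible centres: the vectors `v` all of whose transvections `U_v(c)` lie in `M` -/

section Centres

variable {K : Type*} [Field K] {V : Type*} [AddCommGroup V] [Module K V] (B : LinearMap.BilinForm K V)

/-- **Admissible centres.** `IsCentre B R v`: every one-parameter transvection `U_v(c) = x ↦ x + c ⟨x, v⟩ v`
along `v` lies in Deligne's group `M = oneParamTransvectionGroup B R` (precisely: some element of `M` has
underlying map `U_v(c)`). The proof of Lemme (4.4.2^α) consists in showing that EVERY vector is an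
admissible centre ("les `U_δ` (`δ ∈ V`) sont tous dans `M`, et `M = Sp(V)`").
[cite: Deligne1980, §4.4 (4.4.4^α) p. 228] -/
def IsCentre (R : Set V) (v : V) : Prop :=
  ∀ c : K, ∃ u ∈ oneParamTransvectionGroup B R, (u : V →ₗ[K] V) = oneParamTransvection B v c

variable {B}

/-- The generating vectors are admissible centres. [cite: Deligne1980, §4.4 Lemme (4.4.2^α) p. 227] -/
theorem IsCentre.of_mem (hB : B.IsAlt) {R : Set V} {δ : V} (hδ : δ ∈ R) : IsCentre B R δ := fun c =>
  ⟨_, unit_oneParamTransvection_mem B hδ (hB δ) c, rfl⟩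

/-- `0` is an admissible centre (`U_0(c) = 1`). [cite: Deligne1980, §4.4 (4.4.4^α) p. 227 ("Le cas R = {0} est trivial")] -/
theorem isCentre_zero {R : Set V} : IsCentre B R (0 : V) := fun c =>
  ⟨1, one_mem _, by ext x; simp [oneParamTransvection_apply]⟩

/-- Admissible centres are stable under scalars: `U_{a v}(c) = U_v(c a²)` ("les multiples non nuls de `δ`
sont donc dans `R`"). [cite: Deligne1980, §4.4 (4.4.4^α) p. 227] -/
theorem IsCentre.smul {R : Set V} {v : V} (hv : IsCentre B R v) (a : K) : IsCentre B R (a • v) := fun c => by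
  obtain ⟨u, hu, hu'⟩ := hv (c * a * a)
  refine ⟨u, hu, ?_⟩
  rw [hu']
  ext x
  rw [oneParamTransvection_apply, oneParamTransvection_apply, map_smul, smul_eq_mul, smul_smul]
  congr 1
  ring

/-- `g ∘ U_δ(c) = U_{g δ}(c) ∘ g` for `g` an isometry of `B` ("`τ σ τ⁻¹` ranges over the transvections in
the direction `τA`"). [cite: Deligne1980, §4.4 (4.4.3^α) p. 227] -/
theorem comp_oneParamTransvection_of_isometry {g : V →ₗ[K] V} (hg : ∀ x y, B (g x) (g y) = B x y)
    (δ : V) (c : K) : g ∘ₗ oneParamTransvection B δ c = oneParamTransvection B (g δ) c ∘ₗ g := by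
  ext x
  simp only [LinearMap.coe_comp, Function.comp_apply, oneParamTransvection_apply, map_add, map_smul, hg]

/-- Admissible centres are stable under `M`: `g U_v(c) g⁻¹ = U_{g v}(c)`. [cite: Deligne1980, §4.4 (4.4.3^α) p. 227] -/
theorem IsCentre.map (hB : B.IsAlt) {R : Set V} {v : V} (hv : IsCentre B R v) {g : (V →ₗ[K] V)ˣ}
    (hg : g ∈ oneParamTransvectionGroup B R) : IsCentre B R ((g : V →ₗ[K] V) v) := fun c => by
  obtain ⟨u, hu, hu'⟩ := hv c
  refine ⟨g * u * g⁻¹, mul_mem (mul_mem hg hu) (inv_mem hg), ?_⟩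
  have hiso := oneParamTransvectionGroup_isometry B hB hg
  ext x
  have hgg : (g : V →ₗ[K] V) ((↑g⁻¹ : V →ₗ[K] V) x) = x := by
    rw [← Module.End.mul_apply, ← Units.val_mul, mul_inv_cancel, Units.val_one, Module.End.one_apply]
  have hB' : B ((↑g⁻¹ : V →ₗ[K] V) x) v = B x ((g : V →ₗ[K] V) v) := by rw [← hiso, hgg]
  rw [Units.val_mul, Units.val_mul, hu', Module.End.mul_apply, Module.End.mul_apply, oneParamTransvection_apply,
    oneParamTransvection_apply, map_add, map_smul, hgg, hB']

/-- `U_w(c) v = v + c ⟨v, w⟩ w` is an admissible centre when `v`, `w` are. [cite: Deligne1980, §4.4 (4.4.3^α) p. 227] -/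
theorem IsCentre.add_smul (hB : B.IsAlt) {R : Set V} {v w : V} (hv : IsCentre B R v) (hw : IsCentre B R w)
    (c : K) : IsCentre B R (v + (c * B v w) • w) := by
  obtain ⟨u, hu, hu'⟩ := hw c
  have h := hv.map hB hu
  rwa [hu', oneParamTransvection_apply] at h

/-- **(4.4.3^α)**: for admissible centres `v`, `w` with `⟨v, w⟩ ≠ 0`, every `v + t w` is an admissible
centre ("les combinaisons linéaires non nulles de `δ'` et `δ''` sont dans `R`").
[cite: Deligne1980, §4.4 Lemme (4.4.3^α) p. 227] -/
theorem IsCentre.add_smul_of_ne (hB : B.IsAlt) {R : Set V} {v w : V} (hv : IsCentre B R v)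
    (hw : IsCentre B R w) (hvw : B v w ≠ 0) (t : K) : IsCentre B R (v + t • w) := by
  have h := hv.add_smul hB hw (t / B v w)
  rwa [div_mul_cancel₀ t hvw] at h

/-- `v + w` for non-orthogonal admissible centres. [cite: Deligne1980, §4.4 Lemme (4.4.3^α) p. 227] -/
theorem IsCentre.add_of_ne (hB : B.IsAlt) {R : Set V} {v w : V} (hv : IsCentre B R v) (hw : IsCentre B R w)
    (hvw : B v w ≠ 0) : IsCentre B R (v + w) := by
  simpa only [one_smul] using hv.add_smul_of_ne hB hw hvw 1

/-- Shifting back along an admissible centre: if `x + t s` and `s` are admissible and `⟨x, s⟩ ≠ 0` then `x`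
is admissible. [cite: Deligne1980, §4.4 Lemme (4.4.3^α) p. 227] -/
theorem IsCentre.of_add_smul (hB : B.IsAlt) {R : Set V} {x s : V} {t : K} (h : IsCentre B R (x + t • s))
    (hs : IsCentre B R s) (hxs : B x s ≠ 0) : IsCentre B R x := by
  have h' : B (x + t • s) s ≠ 0 := by
    rwa [map_add, LinearMap.add_apply, map_smul, LinearMap.smul_apply, hB s, smul_zero, add_zero]
  have h2 := h.add_smul_of_ne hB hs h' (-t)
  rwa [add_assoc, ← _root_.add_smul, add_neg_cancel, zero_smul, add_zero] at h2

end Centres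

/-! ## Part II, §6. The growth step: enlarging a subspace whose non-radical vectors are admissible centres -/

section Growth

/-- In an infinite type three values can be avoided. [folklore] -/
private theorem exists_ne_ne_ne {K : Type*} [Infinite K] (a₁ a₂ a₃ : K) : ∃ t : K, t ≠ a₁ ∧ t ≠ a₂ ∧ t ≠ a₃ := by
  classical
  obtain ⟨t, ht⟩ := Infinite.exists_notMem_finset ({a₁, a₂, a₃} : Finset K)
  simp only [Finset.mem_insert, Finset.mem_singleton, not_or] at ht
  exact ⟨t, ht.1, ht.2.1, ht.2.2⟩

variable {K : Type*} [Field K] {V : Type*} [AddCommGroup V] [Module K V] {B : LinearMap.BilinForm K V}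
  {R : Set V}

/-- `p + t q ≠ 0` off the single bad value `t = -p/q` (`q ≠ 0`). [folklore] -/
private theorem add_mul_ne_zero_of_ne_div {p q t : K} (hq : q ≠ 0) (ht : t ≠ -p / q) : p + t * q ≠ 0 := by
  intro h
  apply ht
  rw [eq_div_iff hq]
  linear_combination h

/-- `p + t q ≠ 0` for `p ≠ 0`, off the bad value if `q ≠ 0`. [folklore] -/
private theorem add_mul_ne_zero_of_ne_zero {p q t : K} (hp : p ≠ 0) (ht : q ≠ 0 → t ≠ -p / q) : p + t * q ≠ 0 := by
  by_cases hq : q = 0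
  · rw [hq, mul_zero, add_zero]; exact hp
  · exact add_mul_ne_zero_of_ne_div hq (ht hq)

/-- Three linear functionals, each non-zero somewhere on a subspace `W` of a vector space over an infinite
field, have a common non-zero in `W` (a vector space over an infinite field is not a finite union of
proper subspaces). [folklore] -/
private theorem exists_mem_forall_three_ne_zero [Infinite K] {W : Submodule K V} (f g h : V →ₗ[K] K)
    (hf : ∃ u ∈ W, f u ≠ 0) (hg : ∃ u ∈ W, g u ≠ 0) (hh : ∃ u ∈ W, h u ≠ 0) :
    ∃ u ∈ W, f u ≠ 0 ∧ g u ≠ 0 ∧ h u ≠ 0 := by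
  obtain ⟨u', hu'W, hfu', hgu'⟩ : ∃ u ∈ W, f u ≠ 0 ∧ g u ≠ 0 := by
    obtain ⟨u₁, h₁W, h₁⟩ := hf
    obtain ⟨u₂, h₂W, h₂⟩ := hg
    by_cases hg₁ : g u₁ = 0
    · by_cases hf₂ : f u₂ = 0
      · refine ⟨u₁ + u₂, add_mem h₁W h₂W, ?_, ?_⟩
        · rw [map_add, hf₂, add_zero]; exact h₁
        · rw [map_add, hg₁, zero_add]; exact h₂
      · exact ⟨u₂, h₂W, hf₂, h₂⟩
    · exact ⟨u₁, h₁W, h₁, hg₁⟩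
  obtain ⟨u₃, h₃W, h₃⟩ := hh
  obtain ⟨t, ht₁, ht₂, ht₃⟩ := exists_ne_ne_ne (-(f u') / f u₃) (-(g u') / g u₃) (-(h u') / h u₃)
  refine ⟨u' + t • u₃, add_mem hu'W (Submodule.smul_mem _ t h₃W), ?_, ?_, ?_⟩
  · rw [map_add, map_smul, smul_eq_mul]
    exact add_mul_ne_zero_of_ne_zero hfu' fun _ => ht₁
  · rw [map_add, map_smul, smul_eq_mul]
    exact add_mul_ne_zero_of_ne_zero hgu' fun _ => ht₂
  · rw [map_add, map_smul, smul_eq_mul]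
    exact add_mul_ne_zero_of_ne_div h₃ ht₃

/-- **The growth step (core).** Let `W ≤ V` be a subspace all of whose non-radical vectors are admissible
centres, `ρ` and `s ∈ W` admissible centres with `⟨s, ρ⟩ ≠ 0`, where `s` is non-radical in `W` or
`W = K s`. Then every `w + ρ`, `w ∈ W`, that is non-radical in `W + K ρ` is an admissible centre. This is
the inductive form of Deligne's (4.4.4^α) ("S'il existe `δ ∈ R - W` qui n'est pas orthogonal à `W`, il
résulte de (4.4.3^α) que `R` est dense dans `W ⊕ Cδ`"), with Zariski density replaced by the exact
bookkeeping of the radical of `( , )|W`. [cite: Deligne1980, §4.4 (4.4.4^α) pp. 227–228] -/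
theorem isCentre_add_of_step [Infinite K] (hB : B.IsAlt) {W : Submodule K V}
    (hPW : ∀ y ∈ W, (∃ z ∈ W, B y z ≠ 0) → IsCentre B R y)
    {ρ : V} (hρ : IsCentre B R ρ) {s : V} (hsW : s ∈ W) (hsL : IsCentre B R s) (hsρ : B s ρ ≠ 0)
    (hsrad : (∃ z ∈ W, B s z ≠ 0) ∨ ∀ w ∈ W, ∃ b : K, b • s = w)
    {w : V} (hwW : w ∈ W) (hx : ∃ z ∈ (K ∙ ρ) ⊔ W, B (w + ρ) z ≠ 0) : IsCentre B R (w + ρ) := by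
  by_cases hw : ∃ z ∈ W, B w z ≠ 0
  · have hwL : IsCentre B R w := hPW w hwW hw
    by_cases hwρ : B w ρ = 0
    · -- the pivot case: `w` admissible, `⟨w, ρ⟩ = 0`
      obtain ⟨z, hzW, hwz⟩ := hw
      have h3 : ∃ u ∈ W, B u (w + ρ) ≠ 0 := by
        by_contra hcon
        push Not at hcon
        obtain ⟨z', hz', hne⟩ := hx
        apply hne
        obtain ⟨r, hr, u, huW, rfl⟩ := Submodule.mem_sup.1 hz'
        obtain ⟨a, rfl⟩ := Submodule.mem_span_singleton.1 hr
        rw [map_add, map_smul, ← hB.neg_eq u (w + ρ), hcon u huW, neg_zero, add_zero, smul_eq_mul, map_add B,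
          LinearMap.add_apply, hwρ, hB ρ, add_zero, mul_zero]
      have hzw : B z w ≠ 0 := by rw [← hB.neg_eq, neg_ne_zero]; exact hwz
      obtain ⟨u, huW, h1, h2, h3'⟩ := exists_mem_forall_three_ne_zero (W := W) (B.flip w) (B.flip ρ)
        (B.flip (w + ρ)) ⟨z, hzW, hzw⟩ ⟨s, hsW, hsρ⟩ h3
      replace h1 : B u w ≠ 0 := h1
      replace h2 : B u ρ ≠ 0 := h2
      replace h3' : B u (w + ρ) ≠ 0 := h3'
      have huL : IsCentre B R u := hPW u huW ⟨w, hwW, h1⟩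
      have hwu : IsCentre B R (w + u) :=
        hwL.add_of_ne hB huL (by rw [← hB.neg_eq, neg_ne_zero]; exact h1)
      have hwuρ : IsCentre B R (w + u + ρ) :=
        hwu.add_of_ne hB hρ (by rw [map_add B, LinearMap.add_apply, hwρ, zero_add]; exact h2)
      have e : w + u + ρ = (w + ρ) + (1 : K) • u := by rw [one_smul, add_right_comm]
      rw [e] at hwuρ
      exact hwuρ.of_add_smul hB huL (by rw [← hB.neg_eq, neg_ne_zero]; exact h3')
    · exact hwL.add_of_ne hB hρ hwρ
  · -- `w` is in the radical of `( , )|W`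
    push Not at hw
    rcases hsrad with ⟨z, hzW, hsz⟩ | hWs
    · obtain ⟨t, ht0, ht1, -⟩ := exists_ne_ne_ne (0 : K) (-(B w ρ) / B s ρ) 0
      have h1 : IsCentre B R (w + t • s) := by
        refine hPW _ (add_mem hwW (Submodule.smul_mem _ t hsW)) ⟨z, hzW, ?_⟩
        rw [map_add B, LinearMap.add_apply, hw z hzW, zero_add, map_smul B, LinearMap.smul_apply, smul_eq_mul]
        exact mul_ne_zero ht0 hsz
      have h2 : IsCentre B R (w + t • s + ρ) := by
        refine h1.add_of_ne hB hρ ?_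
        rw [map_add B, LinearMap.add_apply, map_smul B, LinearMap.smul_apply, smul_eq_mul]
        exact add_mul_ne_zero_of_ne_div hsρ ht1
      have e : w + t • s + ρ = (w + ρ) + t • s := add_right_comm _ _ _
      rw [e] at h2
      refine h2.of_add_smul hB hsL ?_
      rw [map_add B, LinearMap.add_apply, hw s hsW, zero_add, ← hB.neg_eq, neg_ne_zero]
      exact hsρ
    · obtain ⟨b, rfl⟩ := hWs w hwW
      have h := hρ.add_smul_of_ne hB hsL (by rw [← hB.neg_eq, neg_ne_zero]; exact hsρ) b
      rwa [add_comm] at h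

/-- **The growth step (subspace form)**: under the hypotheses of `isCentre_add_of_step`, every non-radical
vector of `K ρ + W` is an admissible centre. [cite: Deligne1980, §4.4 (4.4.4^α) pp. 227–228] -/
theorem isCentre_of_mem_sup [Infinite K] (hB : B.IsAlt) {W : Submodule K V}
    (hPW : ∀ y ∈ W, (∃ z ∈ W, B y z ≠ 0) → IsCentre B R y)
    {ρ : V} (hρ : IsCentre B R ρ) {s : V} (hsW : s ∈ W) (hsL : IsCentre B R s) (hsρ : B s ρ ≠ 0)
    (hsrad : (∃ z ∈ W, B s z ≠ 0) ∨ ∀ w ∈ W, ∃ b : K, b • s = w) :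
    ∀ y ∈ (K ∙ ρ) ⊔ W, (∃ z ∈ (K ∙ ρ) ⊔ W, B y z ≠ 0) → IsCentre B R y := by
  intro y hy hyz
  obtain ⟨r, hr, w, hwW, rfl⟩ := Submodule.mem_sup.1 hy
  obtain ⟨a, rfl⟩ := Submodule.mem_span_singleton.1 hr
  by_cases ha : a = 0
  · subst ha
    rw [zero_smul, zero_add] at hyz ⊢
    by_cases hw : ∃ z ∈ W, B w z ≠ 0
    · exact hPW w hwW hw
    · push Not at hw
      have hwρ : B w ρ ≠ 0 := by
        obtain ⟨z', hz', hne⟩ := hyz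
        obtain ⟨r', hr', u, huW, rfl⟩ := Submodule.mem_sup.1 hz'
        obtain ⟨a', rfl⟩ := Submodule.mem_span_singleton.1 hr'
        intro h0
        apply hne
        rw [map_add, map_smul, hw u huW, h0, smul_zero, add_zero]
      have h1 : IsCentre B R (w + ρ) := by
        refine isCentre_add_of_step hB hPW hρ hsW hsL hsρ hsrad hwW ⟨w, Submodule.mem_sup_right hwW, ?_⟩
        rw [map_add B, LinearMap.add_apply, hB w, zero_add, ← hB.neg_eq, neg_ne_zero]
        exact hwρ
      rw [← one_smul K ρ] at h1
      exact h1.of_add_smul hB hρ hwρ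
  · have e : a • ρ + w = a • (a⁻¹ • w + ρ) := by
      rw [smul_add, smul_smul, mul_inv_cancel₀ ha, one_smul, add_comm]
    rw [e]
    refine (isCentre_add_of_step hB hPW hρ hsW hsL hsρ hsrad (Submodule.smul_mem _ _ hwW) ?_).smul a
    obtain ⟨z', hz', hne⟩ := hyz
    refine ⟨z', hz', fun h0 => hne ?_⟩
    rw [e, map_smul B, LinearMap.smul_apply, h0, smul_zero]

/-- **The growth step (finite generating sets)**: the invariant "`S ⊆ R`, the non-radical vectors of
`span S` are admissible centres, and each `s ∈ S` is non-radical in `span S` unless `span S = K s`"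
passes from `S` to `S ∪ {ρ}` for `ρ ∈ R` linked to some `s ∈ S`.
[cite: Deligne1980, §4.4 (4.4.4^α) pp. 227–228] -/
theorem isCentre_invariant_insert [Infinite K] [DecidableEq V] (hB : B.IsAlt)
    (hRL : ∀ r ∈ R, IsCentre B R r) {S : Finset V} (hSR : (S : Set V) ⊆ R)
    (hP : ∀ y ∈ Submodule.span K (S : Set V), (∃ z ∈ Submodule.span K (S : Set V), B y z ≠ 0) →
      IsCentre B R y)
    (hrad : ∀ s ∈ S, (∃ z ∈ Submodule.span K (S : Set V), B s z ≠ 0) ∨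
      ∀ w ∈ Submodule.span K (S : Set V), ∃ b : K, b • s = w)
    {ρ : V} (hρR : ρ ∈ R) {s : V} (hs : s ∈ S) (hsρ : B s ρ ≠ 0) :
    ((insert ρ S : Finset V) : Set V) ⊆ R ∧
    (∀ y ∈ Submodule.span K ((insert ρ S : Finset V) : Set V),
      (∃ z ∈ Submodule.span K ((insert ρ S : Finset V) : Set V), B y z ≠ 0) → IsCentre B R y) ∧
    (∀ s' ∈ insert ρ S, (∃ z ∈ Submodule.span K ((insert ρ S : Finset V) : Set V), B s' z ≠ 0) ∨
      ∀ w ∈ Submodule.span K ((insert ρ S : Finset V) : Set V), ∃ b : K, b • s' = w) := by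
  have hcoe : ((insert ρ S : Finset V) : Set V) = insert ρ (S : Set V) := Finset.coe_insert ρ S
  have hspan : Submodule.span K ((insert ρ S : Finset V) : Set V) = (K ∙ ρ) ⊔ Submodule.span K (S : Set V) := by
    rw [hcoe, Submodule.span_insert]
  refine ⟨?_, ?_, ?_⟩
  · rw [hcoe]
    exact Set.insert_subset hρR hSR
  · rw [hspan]
    exact isCentre_of_mem_sup hB hP (hRL ρ hρR) (Submodule.subset_span hs) (hRL s (hSR hs)) hsρ (hrad s hs)
  · intro s' hs'
    rw [hspan]
    rcases Finset.mem_insert.1 hs' with rfl | hs'S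
    · refine Or.inl ⟨s, Submodule.mem_sup_right (Submodule.subset_span hs), ?_⟩
      rw [← hB.neg_eq, neg_ne_zero]
      exact hsρ
    · rcases hrad s' hs'S with ⟨z, hz, hne⟩ | hall
      · exact Or.inl ⟨z, Submodule.mem_sup_right hz, hne⟩
      · obtain ⟨b, hb⟩ := hall s (Submodule.subset_span hs)
        refine Or.inl ⟨ρ, Submodule.mem_sup_left (Submodule.mem_span_singleton_self ρ), fun h0 => hsρ ?_⟩
        rw [← hb, map_smul B, LinearMap.smul_apply, h0, smul_zero]

/-- **Every vector is an admissible centre** when `R` spans `V` and is not the disjoint union of two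
non-empty mutually orthogonal parts ("On a donc `R = (R ∩ W) ∪ (R ∩ W^⊥)` … `W = V` : … les `U_δ`
(`δ ∈ V`) sont tous dans `M`"): Deligne's (4.4.4^α), run on the orthogonality graph of `R`
(`K` infinite, `B` alternating non-degenerate, `V` finite-dimensional).
[cite: Deligne1980, §4.4 (4.4.4^α) pp. 227–228] -/
theorem isCentre_of_span_eq_top [Infinite K] [FiniteDimensional K V] (hB : B.IsAlt) (hBn : B.Nondegenerate)
    (hR : Submodule.span K R = ⊤)
    (hconn : ∀ A ⊆ R, A.Nonempty → A ≠ R → ∃ r ∈ A, ∃ ρ ∈ R, ρ ∉ A ∧ B r ρ ≠ 0) (v : V) :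
    IsCentre B R v := by
  classical
  have hRL : ∀ r ∈ R, IsCentre B R r := fun r hr => IsCentre.of_mem hB hr
  rcases subsingleton_or_nontrivial V with hV | hV
  · rw [Subsingleton.elim v 0]
    exact isCentre_zero
  obtain ⟨r, hrR, hr0⟩ : ∃ r ∈ R, r ≠ 0 := by
    by_contra h
    push Not at h
    have h' : Submodule.span K R = ⊥ := Submodule.span_eq_bot.2 h
    rw [hR] at h'
    exact top_ne_bot h'
  -- the invariant on finite subsets of `R`
  have key : ∀ n : ℕ, n ≤ Module.finrank K V → ∃ S : Finset V, S.Nonempty ∧ (S : Set V) ⊆ R ∧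
      (∀ y ∈ Submodule.span K (S : Set V), (∃ z ∈ Submodule.span K (S : Set V), B y z ≠ 0) →
        IsCentre B R y) ∧
      (∀ s ∈ S, (∃ z ∈ Submodule.span K (S : Set V), B s z ≠ 0) ∨
        ∀ w ∈ Submodule.span K (S : Set V), ∃ b : K, b • s = w) ∧
      n ≤ Module.finrank K (Submodule.span K (S : Set V)) := by
    intro n
    induction n with
    | zero =>
      intro _
      refine ⟨{r}, Finset.singleton_nonempty r, ?_, ?_, ?_, Nat.zero_le _⟩
      · rw [Finset.coe_singleton, Set.singleton_subset_iff]
        exact hrR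
      · rintro y hy ⟨z, hz, hne⟩
        exfalso
        apply hne
        rw [Finset.coe_singleton] at hy hz
        obtain ⟨a, rfl⟩ := Submodule.mem_span_singleton.1 hy
        obtain ⟨c, rfl⟩ := Submodule.mem_span_singleton.1 hz
        rw [map_smul B, LinearMap.smul_apply, map_smul, hB r, smul_zero, smul_zero]
      · intro s hs
        rw [Finset.mem_singleton] at hs
        subst hs
        refine Or.inr fun w hw => ?_
        rw [Finset.coe_singleton] at hw
        exact Submodule.mem_span_singleton.1 hw
    | succ n ih =>
      intro hn
      obtain ⟨S, hSne, hSR, hP, hrad, hSn⟩ := ih (Nat.le_of_succ_le hn)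
      by_cases htop : Submodule.span K (S : Set V) = ⊤
      · refine ⟨S, hSne, hSR, hP, hrad, ?_⟩
        rw [htop, finrank_top]
        exact hn
      · have hnot : ¬ (R ⊆ Submodule.span K (S : Set V)) := fun h =>
          htop (eq_top_iff.2 (hR ▸ Submodule.span_le.2 h))
        obtain ⟨ρ₀, hρ₀R, hρ₀⟩ := Set.not_subset.1 hnot
        obtain ⟨s₀, hs₀⟩ := hSne
        obtain ⟨a, ⟨-, haS⟩, ρ, hρR, hρA, haρ⟩ := hconn {x | x ∈ R ∧ x ∈ Submodule.span K (S : Set V)}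
          (fun x hx => hx.1) ⟨s₀, hSR hs₀, Submodule.subset_span hs₀⟩
          (fun h => hρ₀ (by rw [Set.ext_iff] at h; exact ((h ρ₀).2 hρ₀R).2))
        have hρS : ρ ∉ Submodule.span K (S : Set V) := fun h => hρA ⟨hρR, h⟩
        have hlink : ∃ s ∈ S, B s ρ ≠ 0 := by
          by_contra hcon
          push Not at hcon
          apply haρ
          have hzero : ∀ x ∈ Submodule.span K (S : Set V), B x ρ = 0 := by
            intro x hx
            induction hx using Submodule.span_induction with
            | mem x hx => exact hcon x hx
            | zero => rw [map_zero, LinearMap.zero_apply]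
            | add x y _ _ hx hy => rw [map_add, LinearMap.add_apply, hx, hy, add_zero]
            | smul c x _ hx => rw [map_smul, LinearMap.smul_apply, hx, smul_zero]
          exact hzero a haS
        obtain ⟨s, hsS, hsρ⟩ := hlink
        obtain ⟨h1, h2, h3⟩ := isCentre_invariant_insert hB hRL hSR hP hrad hρR hsS hsρ
        refine ⟨insert ρ S, Finset.insert_nonempty ρ S, h1, h2, h3, ?_⟩
        have hlt : Submodule.span K (S : Set V) < Submodule.span K ((insert ρ S : Finset V) : Set V) := by
          rw [Finset.coe_insert]
          refine lt_of_le_of_ne (Submodule.span_mono (Set.subset_insert _ _)) fun h => hρS ?_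
          rw [h]
          exact Submodule.subset_span (Set.mem_insert _ _)
        have := Submodule.finrank_lt_finrank_of_lt hlt
        omega
  obtain ⟨S, -, -, hP, -, hSn⟩ := key _ le_rfl
  have htop : Submodule.span K (S : Set V) = ⊤ :=
    Submodule.eq_top_of_finrank_eq (le_antisymm (Submodule.finrank_le _) hSn)
  by_cases hv : v = 0
  · rw [hv]
    exact isCentre_zero
  · have hz : ∃ z, B v z ≠ 0 := by
      by_contra h
      push Not at h
      exact hv (hBn.1 v h)
    obtain ⟨z, hz⟩ := hz
    exact hP v (htop ▸ Submodule.mem_top) ⟨z, htop ▸ Submodule.mem_top, hz⟩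

end Growth

/-! ## Part II, §7. From admissible centres to `M = Sp(V)`: `Sp(V)` is generated by transvections (Artin,
Thm. 3.25 — the tree's `SymplecticMatrix.closure_transvec_eq_top`, transported along a symplectic basis) -/

section Transport

open Matrix Literature.LinearAlgebra.Matrix

variable {K : Type*} [Field K] {V : Type*} [AddCommGroup V] [Module K V] {B : LinearMap.BilinForm K V}
variable {ι : Type*} [Fintype ι] [DecidableEq ι]

/-- The automorphism of `V` with a given symplectic matrix in the basis `b`, as a group homomorphism
`Sp_{2ι}(K) →* GL(V)` (`A ↦ Matrix.toLin b b A`). [cite: Artin1988, Chap. III §5 Def 3.13] -/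
def unitOfSymplecticMatrix (b : Module.Basis (ι ⊕ ι) K V) : Matrix.symplecticGroup ι K →* (V →ₗ[K] V)ˣ where
  toFun A :=
    { val := Matrix.toLin b b (A : Matrix (ι ⊕ ι) (ι ⊕ ι) K)
      inv := Matrix.toLin b b ((A⁻¹ : Matrix.symplecticGroup ι K) : Matrix (ι ⊕ ι) (ι ⊕ ι) K)
      val_inv := by
        rw [Module.End.mul_eq_comp, ← Matrix.toLin_mul b b b, ← Submonoid.coe_mul, mul_inv_cancel,
          Submonoid.coe_one, Matrix.toLin_one]
        rfl
      inv_val := by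
        rw [Module.End.mul_eq_comp, ← Matrix.toLin_mul b b b, ← Submonoid.coe_mul, inv_mul_cancel,
          Submonoid.coe_one, Matrix.toLin_one]
        rfl }
  map_one' := Units.ext (by
    change Matrix.toLin b b ((1 : Matrix.symplecticGroup ι K) : Matrix (ι ⊕ ι) (ι ⊕ ι) K) = LinearMap.id
    rw [Submonoid.coe_one, Matrix.toLin_one])
  map_mul' A A' := Units.ext (by
    change Matrix.toLin b b ((A * A' : Matrix.symplecticGroup ι K) : Matrix (ι ⊕ ι) (ι ⊕ ι) K) =
      Matrix.toLin b b (A : Matrix (ι ⊕ ι) (ι ⊕ ι) K) * Matrix.toLin b b (A' : Matrix (ι ⊕ ι) (ι ⊕ ι) K)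
    rw [Submonoid.coe_mul, Matrix.toLin_mul b b b, Module.End.mul_eq_comp])

/-- Underlying map of `unitOfSymplecticMatrix b A`. [cite: Artin1988, Chap. III §5 Def 3.13] -/
@[simp]
theorem coe_unitOfSymplecticMatrix (b : Module.Basis (ι ⊕ ι) K V) (A : Matrix.symplecticGroup ι K) :
    ((unitOfSymplecticMatrix b A : (V →ₗ[K] V)ˣ) : V →ₗ[K] V) = Matrix.toLin b b (A : Matrix (ι ⊕ ι) (ι ⊕ ι) K) :=
  rfl

/-- In a symplectic basis adapted to Mathlib's `J = (0 -1; 1 0)` the Gram matrix of `B` is `J`.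
[cite: Artin1988, Chap. III §5 Thm 3.7 (hyperbolic planes)] -/
theorem toMatrix_eq_J (b : Module.Basis (ι ⊕ ι) K V)
    (h11 : ∀ i j, B (b (Sum.inl i)) (b (Sum.inl j)) = 0) (h22 : ∀ i j, B (b (Sum.inr i)) (b (Sum.inr j)) = 0)
    (h12 : ∀ i j, B (b (Sum.inl i)) (b (Sum.inr j)) = if i = j then -1 else 0)
    (h21 : ∀ i j, B (b (Sum.inr i)) (b (Sum.inl j)) = if i = j then 1 else 0) :
    LinearMap.BilinForm.toMatrix b B = Matrix.J ι K := by
  ext i j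
  rw [LinearMap.BilinForm.toMatrix_apply, Matrix.J]
  rcases i with i | i <;> rcases j with j | j
  · rw [Matrix.fromBlocks_apply₁₁, h11, Matrix.zero_apply]
  · rw [Matrix.fromBlocks_apply₁₂, h12, Matrix.neg_apply, Matrix.one_apply, apply_ite Neg.neg, neg_zero]
  · rw [Matrix.fromBlocks_apply₂₁, h21, Matrix.one_apply]
  · rw [Matrix.fromBlocks_apply₂₂, h22, Matrix.zero_apply]

/-- In such a basis `B(x, y) = [x] ⬝ (J [y])`, the form of `SymplecticNormalSubgroups`.
[cite: Artin1988, Chap. III §5 Thm 3.7] -/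
theorem apply_eq_dotProduct_J_mulVec (b : Module.Basis (ι ⊕ ι) K V) (hJ : LinearMap.BilinForm.toMatrix b B = Matrix.J ι K)
    (x y : V) : B x y = b.equivFun x ⬝ᵥ (Matrix.J ι K *ᵥ b.equivFun y) := by
  conv_lhs => rw [← Matrix.toBilin_toMatrix b B, hJ]
  rw [Matrix.toBilin_apply]
  simp only [dotProduct, Matrix.mulVec, Finset.mul_sum, Module.Basis.equivFun_apply, mul_assoc]

/-- The matrix of a `B`-isometry in such a basis is symplectic. [cite: Artin1988, Chap. III §5 Def 3.13] -/
theorem toMatrix_mem_symplecticGroup (b : Module.Basis (ι ⊕ ι) K V) (hJ : LinearMap.BilinForm.toMatrix b B = Matrix.J ι K)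
    {g : V →ₗ[K] V} (hg : ∀ x y, B (g x) (g y) = B x y) :
    LinearMap.toMatrix b b g ∈ Matrix.symplecticGroup ι K := by
  rw [SymplecticGroup.mem_iff', ← hJ, ← LinearMap.BilinForm.toMatrix_comp]
  congr 1
  exact LinearMap.BilinForm.ext fun x y => by rw [LinearMap.BilinForm.comp_apply, hg]

/-- **The symplectic transvection `T_{w,c}` of `SymplecticNormalSubgroups` is `U_v(-c)`**, `v = b⁻¹ w`.
[cite: Artin1988, Chap. III §5, (3.41)] -/
theorem toLin_transvec (hB : B.IsAlt) (b : Module.Basis (ι ⊕ ι) K V) (hJ : LinearMap.BilinForm.toMatrix b B = Matrix.J ι K)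
    (w : ι ⊕ ι → K) (c : K) :
    Matrix.toLin b b ((SymplecticMatrix.transvec w c : Matrix.symplecticGroup ι K) : Matrix (ι ⊕ ι) (ι ⊕ ι) K) =
      oneParamTransvection B (b.equivFun.symm w) (-c) := by
  ext x
  apply b.equivFun.injective
  have hθ : ∀ (M : Matrix (ι ⊕ ι) (ι ⊕ ι) K) (y : V), b.equivFun (Matrix.toLin b b M y) = M *ᵥ b.equivFun y :=
    fun M y => by rw [Module.Basis.equivFun_apply, Module.Basis.equivFun_apply, Matrix.repr_toLin]
  rw [hθ, SymplecticMatrix.transvec_mulVec, oneParamTransvection_apply, map_add, map_smul,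
    LinearEquiv.apply_symm_apply, ← hB.neg_eq, apply_eq_dotProduct_J_mulVec b hJ, LinearEquiv.apply_symm_apply,
    mul_neg, neg_mul, neg_neg]

/-- **`M = Sp(V)` once every vector is an admissible centre** ("les `U_δ` (`δ ∈ V`) sont tous dans `M`, et
`M = Sp(V)`"): `Sp(V)` is generated by the transvections `U_v(c)` — Artin's Thm 3.25 in the tree's matrix
form `SymplecticMatrix.closure_transvec_eq_top`, transported along a Darboux basis
(`LinearAlgebra.Alternating.exists_symplecticBasis`). Any field.
[cite: Deligne1980, §4.4 (4.4.4^α) p. 228] [cite: Artin1988, Chap. III Thm 3.25] -/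
theorem mem_oneParamTransvectionGroup_of_forall_isCentre [FiniteDimensional K V] (hB : B.IsAlt)
    (hBn : B.Nondegenerate) {R : Set V} (hL : ∀ v : V, IsCentre B R v) {g : (V →ₗ[K] V)ˣ}
    (hg : ∀ x y, B ((g : V →ₗ[K] V) x) ((g : V →ₗ[K] V) y) = B x y) : g ∈ oneParamTransvectionGroup B R := by
  classical
  obtain ⟨κ, _, _, b₀, h11, h22, h12, h21⟩ := Literature.LinearAlgebra.Alternating.exists_symplecticBasis hB hBn
  let b : Module.Basis (κ ⊕ κ) K V := b₀.reindex (Equiv.sumComm κ κ)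
  have hb₁ : ∀ i, b (Sum.inl i) = b₀ (Sum.inr i) := fun i => by
    rw [Module.Basis.reindex_apply, Equiv.sumComm_symm, Equiv.sumComm_apply, Sum.swap_inl]
  have hb₂ : ∀ i, b (Sum.inr i) = b₀ (Sum.inl i) := fun i => by
    rw [Module.Basis.reindex_apply, Equiv.sumComm_symm, Equiv.sumComm_apply, Sum.swap_inr]
  have hJ : LinearMap.BilinForm.toMatrix b B = Matrix.J κ K :=
    toMatrix_eq_J b (fun i j => by rw [hb₁, hb₁, h22]) (fun i j => by rw [hb₂, hb₂, h11])
      (fun i j => by rw [hb₁, hb₂, h21]) (fun i j => by rw [hb₂, hb₁, h12])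
  let Φ := unitOfSymplecticMatrix b
  let A : Matrix.symplecticGroup κ K := ⟨LinearMap.toMatrix b b (g : V →ₗ[K] V), toMatrix_mem_symplecticGroup b hJ hg⟩
  have hΦA : Φ A = g := Units.ext (Matrix.toLin_toMatrix b b (g : V →ₗ[K] V))
  rw [← hΦA]
  have hA : A ∈ Subgroup.closure
      {T : Matrix.symplecticGroup κ K | ∃ (w : κ ⊕ κ → K) (c : K), SymplecticMatrix.transvec w c = T} := by
    rw [SymplecticMatrix.closure_transvec_eq_top]
    exact Subgroup.mem_top A
  have hmap := Subgroup.mem_map_of_mem Φ hA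
  rw [MonoidHom.map_closure] at hmap
  refine (Subgroup.closure_le _).2 ?_ hmap
  rintro _ ⟨T, ⟨w, c, rfl⟩, rfl⟩
  obtain ⟨u, hu, hu'⟩ := hL (b.equivFun.symm w) (-c)
  have hT : Φ (SymplecticMatrix.transvec w c) = u :=
    Units.ext (by rw [hu']; exact toLin_transvec hB b hJ w c)
  rw [SetLike.mem_coe, hT]
  exact hu

end Transport

/-! ## Part II, §8. Lemma T (connected transvection configurations) and the discharge of Lemme (4.4.2^α) -/

section LemmaT

variable {K : Type*} [Field K] {V : Type*} [AddCommGroup V] [Module K V] {B : LinearMap.BilinForm K V}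

/-- **Transvection groups along a connected spanning configuration are all of `Sp(V)`** ("Lemma T",
group form). Let `K` be an infinite field, `V` a finite-dimensional `K`-space with a non-degenerate
alternating form `B`, and `R ⊆ V` a subset which spans `V` and is ORTHOGONALLY CONNECTED: `R` is not
the disjoint union of two non-empty mutually `B`-orthogonal parts (every non-empty proper `A ⊂ R` has an
`r ∈ A` and a `ρ ∈ R ∖ A` with `B(r, ρ) ≠ 0`). Then the subgroup `M ≤ GL(V)` generated by the
one-parameter transvection groups `U_δ = {x ↦ x + c ⟨x, δ⟩ δ | c ∈ K}`, `δ ∈ R`, is `Sp(V, B)`: an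
automorphism lies in `M` iff it preserves `B`. This is the content of Deligne's proof (4.4.3^α)–(4.4.4^α)
of Lemme (4.4.2^α), whose one-orbit hypothesis serves only to produce connectedness ("On a donc
`R = (R ∩ W) ∪ (R ∩ W^⊥)` […] Puisque `R` est une seule orbite de `M`, on a `R ⊂ W` et `W = V`"); it is
also the special case "centres spanning, axes spanning" of McLaughlin's theorem on irreducible groups
generated by full transvection subgroups (Cameron–Hall's form). Proof here: exact bookkeeping of the
radical (`isCentre_of_span_eq_top`) + generation of `Sp` by transvections
(`mem_oneParamTransvectionGroup_of_forall_isCentre`).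
[cite: Deligne1980, §4.4 Lemme (4.4.2^α), (4.4.3^α)–(4.4.4^α) pp. 227–228] [cite: McLaughlin1967, Theorem] -/
theorem mem_oneParamTransvectionGroup_iff_of_connected [Infinite K] [FiniteDimensional K V] (hB : B.IsAlt)
    (hBn : B.Nondegenerate) {R : Set V} (hR : Submodule.span K R = ⊤)
    (hconn : ∀ A ⊆ R, A.Nonempty → A ≠ R → ∃ r ∈ A, ∃ ρ ∈ R, ρ ∉ A ∧ B r ρ ≠ 0) (g : (V →ₗ[K] V)ˣ) :
    g ∈ oneParamTransvectionGroup B R ↔ ∀ x y : V, B ((g : V →ₗ[K] V) x) ((g : V →ₗ[K] V) y) = B x y :=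
  ⟨fun hg => oneParamTransvectionGroup_isometry B hB hg, fun hg =>
    mem_oneParamTransvectionGroup_of_forall_isCentre hB hBn (isCentre_of_span_eq_top hB hBn hR hconn) hg⟩

/-- Connected spanning transvection configurations: the pointwise form — every `B`-isometry lies in `M`.
[cite: Deligne1980, §4.4 Lemme (4.4.2^α) pp. 227–228] -/
theorem mem_oneParamTransvectionGroup_of_connected [Infinite K] [FiniteDimensional K V] (hB : B.IsAlt)
    (hBn : B.Nondegenerate) {R : Set V} (hR : Submodule.span K R = ⊤)
    (hconn : ∀ A ⊆ R, A.Nonempty → A ≠ R → ∃ r ∈ A, ∃ ρ ∈ R, ρ ∉ A ∧ B r ρ ≠ 0) {g : (V →ₗ[K] V)ˣ}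
    (hg : ∀ x y : V, B ((g : V →ₗ[K] V) x) ((g : V →ₗ[K] V) y) = B x y) : g ∈ oneParamTransvectionGroup B R :=
  (mem_oneParamTransvectionGroup_iff_of_connected hB hBn hR hconn g).2 hg

/-- The inverse of a unit of `End V` whose map is `U_δ(c)` has map `U_δ(-c)`.
[cite: Deligne1980, §4.4 Lemme (4.4.2^α) p. 227] -/
theorem coe_inv_of_coe_eq_oneParamTransvection {K : Type*} [CommRing K] {V : Type*} [AddCommGroup V]
    [Module K V] {B : LinearMap.BilinForm K V} {δ : V} (hδ : B δ δ = 0) {u : (V →ₗ[K] V)ˣ} {c : K}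
    (hu : (u : V →ₗ[K] V) = oneParamTransvection B δ c) :
    ((u⁻¹ : (V →ₗ[K] V)ˣ) : V →ₗ[K] V) = oneParamTransvection B δ (-c) := by
  apply Units.inv_eq_of_mul_eq_one_right
  rw [hu, Module.End.mul_eq_comp, oneParamTransvection_comp B hδ, add_neg_cancel, oneParamTransvection_zero]
  rfl

/-- **One orbit ⇒ orthogonally connected** (Deligne's use of the orbit hypothesis): if `R` is `M`-stable and
`M`-transitive then `R` is not the disjoint union of two non-empty mutually orthogonal parts — each
generator `U_δ(c)`, `δ ∈ R`, maps such a part `A` into itself (for `a ∈ A`: `U_δ(c) a = a + c⟨a, δ⟩δ ∈ R` is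
`a` if `⟨a, δ⟩ = 0`, and otherwise pairs non-trivially with `δ ∈ A`), hence so does `M`, contradicting
transitivity. [cite: Deligne1980, §4.4 (4.4.4^α) p. 228] -/
theorem orthogonallyConnected_of_orbit (hB : B.IsAlt) {R : Set V}
    (hst : ∀ g ∈ oneParamTransvectionGroup B R, ∀ δ ∈ R, (g : V →ₗ[K] V) δ ∈ R)
    (htr : ∀ δ ∈ R, ∀ δ' ∈ R, ∃ g ∈ oneParamTransvectionGroup B R, (g : V →ₗ[K] V) δ = δ') :
    ∀ A ⊆ R, A.Nonempty → A ≠ R → ∃ r ∈ A, ∃ ρ ∈ R, ρ ∉ A ∧ B r ρ ≠ 0 := by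
  intro A hAR hAne hAR'
  by_contra hcon
  push Not at hcon
  -- each generator maps `A` into `A`
  have hgen : ∀ δ ∈ R, ∀ (c : K), ∀ a ∈ A, oneParamTransvection B δ c a ∈ A := by
    intro δ hδ c a ha
    by_cases haδ : B a δ = 0
    · rw [oneParamTransvection_apply, haδ, mul_zero, zero_smul, add_zero]
      exact ha
    · have hδA : δ ∈ A := by
        by_contra h
        exact haδ (hcon a ha δ hδ h)
      have hmem : oneParamTransvection B δ c a ∈ R := by
        have h := hst _ (unit_oneParamTransvection_mem B hδ (hB δ) c) a (hAR ha)
        exact h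
      by_contra h
      have h0 := hcon δ hδA _ hmem h
      rw [oneParamTransvection_apply, map_add, map_smul, hB δ, smul_zero, add_zero] at h0
      exact haδ (by rw [← hB.neg_eq, h0, neg_zero])
  have key : ∀ g ∈ oneParamTransvectionGroup B R,
      ∀ a ∈ A, (g : V →ₗ[K] V) a ∈ A ∧ ((g⁻¹ : (V →ₗ[K] V)ˣ) : V →ₗ[K] V) a ∈ A := by
    intro g hg
    induction hg using Subgroup.closure_induction with
    | mem u hu =>
      obtain ⟨δ, hδ, c, huc⟩ := hu
      intro a ha
      refine ⟨?_, ?_⟩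
      · rw [huc]
        exact hgen δ hδ c a ha
      · rw [coe_inv_of_coe_eq_oneParamTransvection (hB δ) huc]
        exact hgen δ hδ (-c) a ha
    | one => intro a ha; exact ⟨ha, by rw [inv_one]; exact ha⟩
    | mul g h _ _ ihg ihh =>
      intro a ha
      refine ⟨?_, ?_⟩
      · rw [Units.val_mul, Module.End.mul_apply]
        exact (ihg _ (ihh a ha).1).1
      · rw [_root_.mul_inv_rev, Units.val_mul, Module.End.mul_apply]
        exact (ihh _ (ihg a ha).2).2
    | inv g _ ih =>
      intro a ha
      exact ⟨(ih a ha).2, by rw [inv_inv]; exact (ih a ha).1⟩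
  obtain ⟨r, hr⟩ := hAne
  obtain ⟨ρ, hρR, hρA⟩ : ∃ ρ ∈ R, ρ ∉ A := by
    by_contra h
    push Not at h
    exact hAR' (Set.Subset.antisymm hAR h)
  obtain ⟨g, hg, hgr⟩ := htr r (hAR hr) ρ hρR
  exact hρA (hgr ▸ (key g hg r hr).1)

/-- **Deligne's one-orbit lemma (Weil II, Lemme (4.4.2^α)) holds**: the DISCHARGE of the named fact
`Deligne1980_oneParamTransvectionGroup_eq_sp` — over `ℂ`, a single `M`-orbit `R` spanning `V` is
orthogonally connected (`orthogonallyConnected_of_orbit`), so Lemma T applies.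
[cite: Deligne1980, §4.4 Lemme (4.4.2^α) pp. 227–228] -/
theorem Deligne1980_oneParamTransvectionGroup_eq_sp_holds : Deligne1980_oneParamTransvectionGroup_eq_sp := by
  intro V _ _ _ B hB hBn R hR hst htr g
  haveI : Infinite ℂ := Infinite.of_injective ((↑) : ℕ → ℂ) Nat.cast_injective
  exact mem_oneParamTransvectionGroup_iff_of_connected hB hBn hR (orthogonallyConnected_of_orbit hB hst htr) g

end LemmaT

end Literature.AlgebraicGeometry.HodgeTheory

end
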